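import Mathlib.Algebra.MvPolynomial.PDeriv
import Mathlib.RingTheory.MvPolynomial.EulerIdentity
import Mathlib.RingTheory.MvPolynomial.Homogeneous
import Mathlib.Data.Nat.Factorial.Basic
import Mathlib.Data.Real.Basic
import HarnessLib

/-!
# The Fischer (Bombieri–Fock) inner product on real polynomials and the bound `‖Δp‖ ≤ √(n(n+d-2)) ‖p‖`

For real polynomials in finitely many variables `ι` (`d = |ι|`) the *Fischer inner product* is
`⟨p, q⟩_F = Σ_α α! p_α q_α` (`α! = ∏ᵢ (αᵢ)!`). Its basic property is that multiplication by `xᵢ`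
is adjoint to `∂ᵢ`: `⟨∂ᵢ p, q⟩_F = ⟨p, xᵢ q⟩_F` (so that, on homogeneous polynomials, it is the
Bargmann–Fock / Segal inner product, and under the Wiener–Hermite isometry it becomes the
`L²(γ)` inner product of Wick polynomials). We prove:

* bilinearity, symmetry, positivity, the monomial formula, adjointness
  (`fischerInner_pderiv_left`), `‖xᵢ q‖² = ‖q‖² + ‖∂ᵢ q‖²`, and the cross-term identity
  `⟨xᵢ ∂ⱼ p, xⱼ ∂ᵢ p⟩ = δᵢⱼ ‖∂ᵢ p‖² + ⟨∂ᵢ² p, ∂ⱼ² p⟩`;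
* for `p` homogeneous of degree `n`: `Σᵢ ‖∂ᵢ p‖² = n ‖p‖²` (Euler) and
  `Σᵢⱼ ‖∂ᵢ∂ⱼ p‖² = n (n - 1) ‖p‖²`;
* **the Laplacian bound** `‖Δ p‖²_F ≤ n (n + d - 2) ‖p‖²_F` for `p` homogeneous of degree `n`
  (`fischerInner_laplacian_self_le`), obtained from `0 ≤ Σᵢⱼ ‖xᵢ ∂ⱼ p - xⱼ ∂ᵢ p‖²_F`, i.e. from
  the non-positivity of the squared angular momentum `Σ_{i<j} L_{ij}²` in Fock space
  (`r² Δ = N (N + d - 2) + Σ_{i<j} L_{ij}²`). Equality holds iff `xᵢ ∂ⱼ p = xⱼ ∂ᵢ p` for all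
  `i, j`, i.e. for the rotation-invariant `p = c |x|ⁿ` (`n` even); for harmonic `p` the left-hand
  side is `0`.

This is the algebraic input of the spectral-gap estimate for the pseudo-Maxwellian linearised
Boltzmann operator (`Literature.Analysis.UnboundedOperators.LinearizedBoltzmann`), where it bounds
the fourth spherical moment of second directional derivatives of a Wiener chaos.

## References
* E. Fischer, *Über die Differentiationsprozesse der Algebra*, J. reine angew. Math. 148 (1918) 1–78.
* E. M. Stein, G. Weiss, *Introduction to Fourier Analysis on Euclidean Spaces* (1971), Ch. IV §2
  (the inner product `⟨P, Q⟩ = P(D) Q̄` on homogeneous polynomials and the harmonic decomposition).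
-/

open MvPolynomial Finset
open scoped Nat

namespace Literature.Algebra.Polynomial

noncomputable section

variable {ι : Type*} [Fintype ι] [DecidableEq ι]

/-- The multi-index factorial `α! = ∏ᵢ (αᵢ)!`, as a real number. [folklore] -/
def mfactorial (α : ι →₀ ℕ) : ℝ := ∏ i, ((α i)! : ℝ)

omit [DecidableEq ι] in
/-- `α! > 0`. [folklore] -/
theorem mfactorial_pos (α : ι →₀ ℕ) : 0 < mfactorial α :=
  Finset.prod_pos fun i _ => by exact_mod_cast Nat.factorial_pos (α i)

/-- `(α + eᵢ)! = α! (αᵢ + 1)`. [folklore] -/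
theorem mfactorial_add_single (α : ι →₀ ℕ) (i : ι) :
    mfactorial (α + Finsupp.single i 1) = mfactorial α * (α i + 1) := by
  unfold mfactorial
  rw [← Finset.mul_prod_erase univ _ (mem_univ i), ← Finset.mul_prod_erase univ
    (fun j => ((α j)! : ℝ)) (mem_univ i)]
  have h : ∀ j ∈ univ.erase i, (((α + Finsupp.single i 1 : ι →₀ ℕ) j)! : ℝ) = ((α j)! : ℝ) := by
    intro j hj
    simp [Ne.symm (ne_of_mem_erase hj)]
  rw [Finset.prod_congr rfl h, Finsupp.add_apply, Finsupp.single_eq_same, Nat.factorial_succ]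
  push_cast
  ring

/-- The **Fischer inner product** `⟨p, q⟩_F = Σ_α α! p_α q_α` of two real polynomials
(Fischer 1918; Stein–Weiss IV §2). [folklore] -/
def fischerInner (p q : MvPolynomial ι ℝ) : ℝ :=
  ∑ α ∈ p.support ∪ q.support, mfactorial α * (coeff α p * coeff α q)

/-- The defining sum may be taken over any finite set of multi-indices containing the supports. [folklore] -/
theorem fischerInner_eq_sum_of_subset {p q : MvPolynomial ι ℝ} {s : Finset (ι →₀ ℕ)}
    (h : p.support ∪ q.support ⊆ s) :
    fischerInner p q = ∑ α ∈ s, mfactorial α * (coeff α p * coeff α q) := by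
  unfold fischerInner
  refine Finset.sum_subset h fun α _ hα => ?_
  rw [Finset.mem_union, not_or, MvPolynomial.notMem_support_iff,
    MvPolynomial.notMem_support_iff] at hα
  rw [hα.1, zero_mul, mul_zero]

/-- Symmetry. [folklore] -/
theorem fischerInner_comm (p q : MvPolynomial ι ℝ) : fischerInner p q = fischerInner q p := by
  rw [fischerInner_eq_sum_of_subset (s := p.support ∪ q.support) subset_rfl,
    fischerInner_eq_sum_of_subset (s := p.support ∪ q.support) (by rw [union_comm])]
  exact Finset.sum_congr rfl fun α _ => by ring

/-- Additivity in the first argument. [folklore] -/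
theorem fischerInner_add_left (p₁ p₂ q : MvPolynomial ι ℝ) :
    fischerInner (p₁ + p₂) q = fischerInner p₁ q + fischerInner p₂ q := by
  set s := p₁.support ∪ p₂.support ∪ (p₁ + p₂).support ∪ q.support with hs
  rw [fischerInner_eq_sum_of_subset (s := s), fischerInner_eq_sum_of_subset (s := s),
    fischerInner_eq_sum_of_subset (s := s), ← Finset.sum_add_distrib]
  · refine Finset.sum_congr rfl fun α _ => ?_
    rw [coeff_add]
    ring
  all_goals intro x hx; simp only [hs, Finset.mem_union] at hx ⊢; tauto

/-- Homogeneity in the first argument. [folklore] -/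
theorem fischerInner_smul_left (c : ℝ) (p q : MvPolynomial ι ℝ) :
    fischerInner (c • p) q = c * fischerInner p q := by
  set s := p.support ∪ (c • p).support ∪ q.support with hs
  rw [fischerInner_eq_sum_of_subset (s := s), fischerInner_eq_sum_of_subset (s := s),
    Finset.mul_sum]
  · refine Finset.sum_congr rfl fun α _ => ?_
    rw [coeff_smul, smul_eq_mul]
    ring
  all_goals intro x hx; simp only [hs, Finset.mem_union] at hx ⊢; tauto

/-- Additivity in the second argument. [folklore] -/
theorem fischerInner_add_right (p q₁ q₂ : MvPolynomial ι ℝ) :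
    fischerInner p (q₁ + q₂) = fischerInner p q₁ + fischerInner p q₂ := by
  rw [fischerInner_comm, fischerInner_add_left, fischerInner_comm q₁, fischerInner_comm q₂]

/-- Homogeneity in the second argument. [folklore] -/
theorem fischerInner_smul_right (c : ℝ) (p q : MvPolynomial ι ℝ) :
    fischerInner p (c • q) = c * fischerInner p q := by
  rw [fischerInner_comm, fischerInner_smul_left, fischerInner_comm]

/-- `⟨0, q⟩ = 0`. [folklore] -/
@[simp]
theorem fischerInner_zero_left (q : MvPolynomial ι ℝ) : fischerInner 0 q = 0 := by
  rw [← zero_smul ℝ (0 : MvPolynomial ι ℝ), fischerInner_smul_left, zero_mul]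

/-- `⟨p, 0⟩ = 0`. [folklore] -/
@[simp]
theorem fischerInner_zero_right (p : MvPolynomial ι ℝ) : fischerInner p 0 = 0 := by
  rw [fischerInner_comm, fischerInner_zero_left]

/-- `⟨-p, q⟩ = -⟨p, q⟩`. [folklore] -/
theorem fischerInner_neg_left (p q : MvPolynomial ι ℝ) :
    fischerInner (-p) q = -fischerInner p q := by
  rw [← neg_one_smul ℝ p, fischerInner_smul_left, neg_one_mul]

/-- `⟨p, -q⟩ = -⟨p, q⟩`. [folklore] -/
theorem fischerInner_neg_right (p q : MvPolynomial ι ℝ) :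
    fischerInner p (-q) = -fischerInner p q := by
  rw [fischerInner_comm, fischerInner_neg_left, fischerInner_comm]

/-- `⟨p₁ - p₂, q⟩ = ⟨p₁, q⟩ - ⟨p₂, q⟩`. [folklore] -/
theorem fischerInner_sub_left (p₁ p₂ q : MvPolynomial ι ℝ) :
    fischerInner (p₁ - p₂) q = fischerInner p₁ q - fischerInner p₂ q := by
  rw [sub_eq_add_neg, fischerInner_add_left, fischerInner_neg_left, ← sub_eq_add_neg]

/-- `⟨p, q₁ - q₂⟩ = ⟨p, q₁⟩ - ⟨p, q₂⟩`. [folklore] -/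
theorem fischerInner_sub_right (p q₁ q₂ : MvPolynomial ι ℝ) :
    fischerInner p (q₁ - q₂) = fischerInner p q₁ - fischerInner p q₂ := by
  rw [fischerInner_comm, fischerInner_sub_left, fischerInner_comm q₁, fischerInner_comm q₂]

/-- `⟨Σₖ fₖ, q⟩ = Σₖ ⟨fₖ, q⟩`. [folklore] -/
theorem fischerInner_sum_left {κ : Type*} (s : Finset κ) (f : κ → MvPolynomial ι ℝ)
    (q : MvPolynomial ι ℝ) :
    fischerInner (∑ k ∈ s, f k) q = ∑ k ∈ s, fischerInner (f k) q :=
  map_sum (AddMonoidHom.mk' (fun p => fischerInner p q) fun a b => fischerInner_add_left a b q) f s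

/-- `⟨p, Σₖ fₖ⟩ = Σₖ ⟨p, fₖ⟩`. [folklore] -/
theorem fischerInner_sum_right {κ : Type*} (s : Finset κ) (p : MvPolynomial ι ℝ)
    (f : κ → MvPolynomial ι ℝ) :
    fischerInner p (∑ k ∈ s, f k) = ∑ k ∈ s, fischerInner p (f k) := by
  rw [fischerInner_comm, fischerInner_sum_left]
  exact Finset.sum_congr rfl fun k _ => fischerInner_comm _ _

/-- `⟨p, p⟩ = Σ_α α! p_α²`. [folklore] -/
theorem fischerInner_self_eq (p : MvPolynomial ι ℝ) :
    fischerInner p p = ∑ α ∈ p.support, mfactorial α * coeff α p ^ 2 := by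
  rw [fischerInner_eq_sum_of_subset (s := p.support) (by rw [union_self])]
  exact Finset.sum_congr rfl fun α _ => by ring

/-- Positivity: `⟨p, p⟩ ≥ 0`. [folklore] -/
theorem fischerInner_self_nonneg (p : MvPolynomial ι ℝ) : 0 ≤ fischerInner p p := by
  rw [fischerInner_self_eq]
  exact Finset.sum_nonneg fun α _ => mul_nonneg (mfactorial_pos α).le (sq_nonneg _)

/-- The monomial formula `⟨a x^α, b x^β⟩ = δ_{αβ} α! a b`. [folklore] -/
theorem fischerInner_monomial (α β : ι →₀ ℕ) (a b : ℝ) :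
    fischerInner (monomial α a) (monomial β b) =
      if α = β then mfactorial α * (a * b) else 0 := by
  rw [fischerInner_eq_sum_of_subset (s := {α, β})]
  · by_cases h : α = β
    · subst h
      simp [coeff_monomial]
    · rw [Finset.sum_pair h]
      simp [coeff_monomial, h, Ne.symm h]
  · intro x hx
    simp only [Finset.mem_union, mem_support_iff, coeff_monomial, ne_eq, ite_eq_right_iff,
      Classical.not_imp] at hx
    simp only [Finset.mem_insert, Finset.mem_singleton]
    rcases hx with hx | hx
    · exact Or.inl hx.1.symm
    · exact Or.inr hx.1.symm

/-- **Adjointness**: `⟨∂ᵢ p, q⟩_F = ⟨p, xᵢ q⟩_F` — multiplication by `xᵢ` is the Fischer adjoint of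
`∂ᵢ` (creation/annihilation). [folklore] -/
theorem fischerInner_pderiv_left (i : ι) (p q : MvPolynomial ι ℝ) :
    fischerInner (pderiv i p) q = fischerInner p (X i * q) := by
  induction p using MvPolynomial.induction_on' with
  | monomial α a =>
    induction q using MvPolynomial.induction_on' with
    | monomial β b =>
      rw [pderiv_monomial, X, monomial_mul, fischerInner_monomial, fischerInner_monomial, one_mul]
      by_cases hi : α i = 0
      · have hne : α ≠ Finsupp.single i 1 + β := fun h => by
          rw [h, Finsupp.add_apply, Finsupp.single_eq_same] at hi
          omega
        simp [hi, hne]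
      · by_cases h : α - Finsupp.single i 1 = β
        · have h' : α = Finsupp.single i 1 + β := by
            rw [← h, add_comm, Finsupp.sub_add_single_one_cancel hi]
          rw [if_pos h, if_pos h']
          have hw : mfactorial α = mfactorial (α - Finsupp.single i 1) * (α i) := by
            conv_lhs => rw [← Finsupp.sub_add_single_one_cancel hi]
            rw [mfactorial_add_single, Finsupp.tsub_apply, Finsupp.single_eq_same]
            congr 1
            have : 1 ≤ α i := Nat.one_le_iff_ne_zero.2 hi
            push_cast [Nat.cast_sub this]
            ring
          rw [hw]
          ring
        · have h' : α ≠ Finsupp.single i 1 + β := fun h' =>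
            h (by rw [h', add_comm, add_tsub_cancel_right])
          rw [if_neg h, if_neg h']
    | add q₁ q₂ hq₁ hq₂ =>
      rw [mul_add, fischerInner_add_right, fischerInner_add_right, hq₁, hq₂]
  | add p₁ p₂ hp₁ hp₂ =>
    rw [map_add, fischerInner_add_left, fischerInner_add_left, hp₁, hp₂]

/-- `⟨p, ∂ᵢ q⟩_F = ⟨xᵢ p, q⟩_F`. [folklore] -/
theorem fischerInner_pderiv_right (i : ι) (p q : MvPolynomial ι ℝ) :
    fischerInner p (pderiv i q) = fischerInner (X i * p) q := by
  rw [fischerInner_comm, fischerInner_pderiv_left, fischerInner_comm]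

/-- `‖xᵢ q‖²_F = ‖q‖²_F + ‖∂ᵢ q‖²_F` (the canonical commutation relation `[∂ᵢ, xᵢ] = 1`). [folklore] -/
theorem fischerInner_X_mul_self (i : ι) (q : MvPolynomial ι ℝ) :
    fischerInner (X i * q) (X i * q) =
      fischerInner q q + fischerInner (pderiv i q) (pderiv i q) := by
  rw [← fischerInner_pderiv_left, pderiv_mul, pderiv_X_self, one_mul, fischerInner_add_left,
    fischerInner_comm (X i * _), ← fischerInner_pderiv_left]

/-- The cross term `⟨xᵢ ∂ⱼ p, xⱼ ∂ᵢ p⟩_F = δᵢⱼ ‖∂ᵢ p‖²_F + ⟨∂ᵢ∂ᵢ p, ∂ⱼ∂ⱼ p⟩_F`. [folklore] -/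
theorem fischerInner_X_mul_pderiv_cross (i j : ι) (p : MvPolynomial ι ℝ) :
    fischerInner (X i * pderiv j p) (X j * pderiv i p) =
      (if i = j then fischerInner (pderiv i p) (pderiv i p) else 0) +
        fischerInner (pderiv i (pderiv i p)) (pderiv j (pderiv j p)) := by
  rw [fischerInner_comm, ← fischerInner_pderiv_left, pderiv_mul, pderiv_X, fischerInner_add_left]
  congr 1
  · by_cases h : i = j
    · subst h
      simp
    · simp [h]
  · rw [fischerInner_comm, ← fischerInner_pderiv_left, fischerInner_comm]

/-! ### Homogeneous polynomials: Euler identities -/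

/-- **Euler's identity in Fock space**: `Σᵢ ‖∂ᵢ p‖²_F = n ‖p‖²_F` for `p` homogeneous of degree `n`
(`Σᵢ xᵢ ∂ᵢ` is the number operator). [folklore] -/
theorem sum_fischerInner_pderiv_self {p : MvPolynomial ι ℝ} {n : ℕ} (hp : p.IsHomogeneous n) :
    ∑ i, fischerInner (pderiv i p) (pderiv i p) = n * fischerInner p p := by
  calc ∑ i, fischerInner (pderiv i p) (pderiv i p)
      = ∑ i, fischerInner p (X i * pderiv i p) :=
        Finset.sum_congr rfl fun i _ => fischerInner_pderiv_left i p _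
    _ = fischerInner p (∑ i, X i * pderiv i p) := (fischerInner_sum_right _ _ _).symm
    _ = n * fischerInner p p := by
        rw [hp.sum_X_mul_pderiv, ← Nat.cast_smul_eq_nsmul ℝ, fischerInner_smul_right]

/-- `Σᵢⱼ ‖∂ᵢ ∂ⱼ p‖²_F = n (n - 1) ‖p‖²_F` for `p` homogeneous of degree `n`. [folklore] -/
theorem sum_sum_fischerInner_pderiv_pderiv_self {p : MvPolynomial ι ℝ} {n : ℕ}
    (hp : p.IsHomogeneous n) :
    ∑ j, ∑ i, fischerInner (pderiv i (pderiv j p)) (pderiv i (pderiv j p)) =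
      n * (n - 1 : ℕ) * fischerInner p p := by
  have h : ∀ j, ∑ i, fischerInner (pderiv i (pderiv j p)) (pderiv i (pderiv j p)) =
      (n - 1 : ℕ) * fischerInner (pderiv j p) (pderiv j p) := fun j =>
    sum_fischerInner_pderiv_self hp.pderiv
  simp_rw [h]
  rw [← Finset.mul_sum, sum_fischerInner_pderiv_self hp]
  ring

omit [Fintype ι] in
/-- `∂ᵢ ∂ⱼ = ∂ⱼ ∂ᵢ` on polynomials (stated over `ℝ` for use with the Fischer product; the same
proof works over any commutative semiring). [folklore] -/
theorem pderiv_pderiv_comm (i j : ι) (p : MvPolynomial ι ℝ) :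
    pderiv i (pderiv j p) = pderiv j (pderiv i p) := by
  induction p using MvPolynomial.induction_on with
  | C a => simp
  | add p q hp hq => simp [map_add, hp, hq]
  | mul_X p k h =>
    simp only [pderiv_mul, map_add, h, pderiv_X]
    by_cases hik : i = k <;> by_cases hjk : j = k <;> simp [hik, hjk]

/-! ### The Laplacian bound -/

/-- **Fock-space Laplacian bound.** For a real polynomial `p` in `d` variables, homogeneous of
degree `n`, `‖Δ p‖²_F ≤ n (n + d - 2) ‖p‖²_F` where `Δ = Σᵢ ∂ᵢ²` and `‖·‖_F` is the Fischer norm.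
Proof: `0 ≤ Σᵢⱼ ‖xᵢ ∂ⱼ p - xⱼ ∂ᵢ p‖²_F = 2 (d n + n (n - 1)) ‖p‖² - 2 (n ‖p‖² + ‖Δ p‖²)`
(non-positivity of `Σ L_{ij}²`, i.e. `r² Δ = N (N + d - 2) + Σ_{i<j} L_{ij}²`; Stein–Weiss IV §2).
Equality holds iff `xᵢ ∂ⱼ p = xⱼ ∂ᵢ p` for all `i, j` (`p` a multiple of `|x|ⁿ`); harmonic `p` give the
trivial case `Δ p = 0`. [folklore] -/
theorem fischerInner_laplacian_self_le {p : MvPolynomial ι ℝ} {n : ℕ} (hp : p.IsHomogeneous n) :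
    fischerInner (∑ i, pderiv i (pderiv i p)) (∑ i, pderiv i (pderiv i p)) ≤
      n * (n + Fintype.card ι - 2 : ℝ) * fischerInner p p := by
  rcases Nat.eq_zero_or_pos n with hn | hn
  · -- constants: both sides vanish
    subst hn
    rw [← totalDegree_zero_iff_isHomogeneous, totalDegree_eq_zero_iff_eq_C] at hp
    have hpd : ∀ i, pderiv i p = 0 := fun i => by rw [hp, pderiv_C]
    simp [hpd]
  have hD1 : ∑ i, fischerInner (pderiv i p) (pderiv i p) = n * fischerInner p p :=
    sum_fischerInner_pderiv_self hp
  have hD2 : ∑ j, ∑ i, fischerInner (pderiv i (pderiv j p)) (pderiv i (pderiv j p)) =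
      n * (n - 1 : ℕ) * fischerInner p p := sum_sum_fischerInner_pderiv_pderiv_self hp
  have hc : ((n - 1 : ℕ) : ℝ) = n - 1 := by rw [Nat.cast_sub hn, Nat.cast_one]
  rw [hc] at hD2
  -- the nonnegative quantity `Σᵢⱼ ‖xᵢ ∂ⱼ p - xⱼ ∂ᵢ p‖²`
  have hnonneg : 0 ≤ ∑ i, ∑ j, fischerInner (X i * pderiv j p - X j * pderiv i p)
      (X i * pderiv j p - X j * pderiv i p) :=
    Finset.sum_nonneg fun i _ => Finset.sum_nonneg fun j _ => fischerInner_self_nonneg _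
  -- expand each summand
  have hexp : ∀ i j, fischerInner (X i * pderiv j p - X j * pderiv i p)
      (X i * pderiv j p - X j * pderiv i p) =
      (fischerInner (pderiv j p) (pderiv j p) +
          fischerInner (pderiv i (pderiv j p)) (pderiv i (pderiv j p))) +
        (fischerInner (pderiv i p) (pderiv i p) +
          fischerInner (pderiv j (pderiv i p)) (pderiv j (pderiv i p))) -
        (2 * (if i = j then fischerInner (pderiv i p) (pderiv i p) else 0) +
          2 * fischerInner (pderiv i (pderiv i p)) (pderiv j (pderiv j p))) := by
    intro i j
    rw [fischerInner_sub_left, fischerInner_sub_right, fischerInner_sub_right,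
      fischerInner_X_mul_self, fischerInner_X_mul_self, fischerInner_X_mul_pderiv_cross,
      fischerInner_comm (X j * pderiv i p) (X i * pderiv j p), fischerInner_X_mul_pderiv_cross]
    ring
  simp_rw [hexp, Finset.sum_sub_distrib, Finset.sum_add_distrib] at hnonneg
  -- evaluate the six double sums
  have hS1 : ∑ _i : ι, ∑ j, fischerInner (pderiv j p) (pderiv j p) =
      Fintype.card ι * (n * fischerInner p p) := by
    rw [Finset.sum_const, Finset.card_univ, nsmul_eq_mul, hD1]
  have hS2 : ∑ i : ι, ∑ j, fischerInner (pderiv i (pderiv j p)) (pderiv i (pderiv j p)) =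
      n * (n - 1 : ℝ) * fischerInner p p := by
    rw [Finset.sum_comm, hD2]
  have hS3 : ∑ i : ι, ∑ _j : ι, fischerInner (pderiv i p) (pderiv i p) =
      Fintype.card ι * (n * fischerInner p p) := by
    simp_rw [Finset.sum_const, Finset.card_univ, nsmul_eq_mul]
    rw [← Finset.mul_sum, hD1]
  have hS4 : ∑ i : ι, ∑ j, fischerInner (pderiv j (pderiv i p)) (pderiv j (pderiv i p)) =
      n * (n - 1 : ℝ) * fischerInner p p := hD2
  have hS5 : ∑ i : ι, ∑ j, (2 : ℝ) * (if i = j then fischerInner (pderiv i p) (pderiv i p)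
      else 0) = 2 * (n * fischerInner p p) := by
    have h5 : ∀ i : ι, ∑ j, (2 : ℝ) * (if i = j then fischerInner (pderiv i p) (pderiv i p)
        else 0) = 2 * fischerInner (pderiv i p) (pderiv i p) := fun i => by
      rw [← Finset.mul_sum, Finset.sum_ite_eq, if_pos (Finset.mem_univ i)]
    simp_rw [h5]
    rw [← Finset.mul_sum, hD1]
  have hS6 : ∑ i : ι, ∑ j, (2 : ℝ) * fischerInner (pderiv i (pderiv i p))
      (pderiv j (pderiv j p)) =
      2 * fischerInner (∑ i, pderiv i (pderiv i p)) (∑ i, pderiv i (pderiv i p)) := by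
    rw [fischerInner_sum_left, Finset.mul_sum]
    refine Finset.sum_congr rfl fun i _ => ?_
    rw [fischerInner_sum_right, Finset.mul_sum]
  rw [hS1, hS2, hS3, hS4, hS5, hS6] at hnonneg
  have hP := fischerInner_self_nonneg p
  nlinarith [hnonneg, hP]

end

end Literature.Algebra.Polynomial
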